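import Summits.Schanuel.Schanuel.Theorems.RootDecomp1KDescent02

/-!
# RootDecomp1KDescent — lens 1, generation 58, NODE 19 «DESCENT ON THE K-LINE» (Chevalley–Weil 2-descent to an étale double cover, then 2-adic Runge on the cover; RULE K-R49 (iii) payable clause; CLAIM L2723, PRICE L2727, K-R50) — continuation (RootDecomp1KDescent03): §7 the lift read in ℂ₂, §8 the norm ν, the archimedean size of I, the endgame

(lens-1 g58 NODE 19 HOME kernel K = HOME/decomp-schanuel-lens-1/g58/Descent.lean 92ee3617…, 1568 l, 121 thm + 32 defs/structures (structure DescentCert, structure EisQ), imports tree …RootDecomp1KRunge06 ONLY = the port of node 18 (no Literature import, no fact def, no private, no set_option, no axiom / instance / sorry / native_decide); Probe / Ctrl0 / Ctrl (56 planted controls, ctrl_table19.txt) + NODE-g58.md + cert58.json/.txt + SHA256SUMS (34 files); CLAIM L2723, writer CHECK NOTE L2724/L2725 (certificate arithmetic reproduced at 13 values of λ), crit g10 EX-ANTE PRICE L2727 (ONE THEOREM ×1 for (A) engine + (B) the class DJ(3^j) + (C) territory JOINTLY iff CHECKLIST K-g58 (1)–(10); RULE K-R50 pre-announced; node-18 label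 erratum), census LIVENESS-v10 L2733 (keys k2 / desc2; DJ rows; of record L2735), NODE L2743, critic VERDICT L2746 (crit g10): CLEARED — THEOREM ×1 for (A) engine + (B) the class {DJ 3^j} + (C) territory JOINTLY under RULE K-R49 (iii) («an infinite class of K-R49-territory pairs made unconditional», currency LevelFinite — strictly stronger than the residual ThinFibreAt 2), checklist K-g58 (1)–(10) met, rung 0; labels of record: VARIANT of a KNOWN TOOL (Levin 2008 §3 Thm 6 «Coverings and Runge's method» [corpus:paper:arxiv-0805.1345 p.7]) · PROBLEM-RELATIVE NEW (first descent on the K-line; first members outside every Runge-certifiable class; first LevelFinite for a positive-genus non-uniformised member); RULE K-R50 FIXED (toolkit of record ∪= 2-DESCENT via ℚ-rational 2-torsion of the Jacobian — for k = 2 a factorisation of Δ_x = c₁² − 4c₀c₂ over ℚ, in particular the square type −4·A·B with A + B = c₂ — twists killed by congruences / supports, then any toolkit step upstairs, every further such member / family / presentation / cover degree 2^r / Eisenstein prime / the abstract Descent2At engine ×0-as-record; OPEN TERRITORY at m₀ = 2 := K-R49 territory ∧ Jac has NO ℚ-rational 2-torsion datum — for k = 2 certified by «Δ_x ℚ-irreducible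 of degree ≡ 2 (mod 4)»; standing witness W4 (census TM33); UNCONDITIONAL PART ∪= {DJ 3^j} at the currency LevelFinite); PORT GO exactly as census STAGING NOTE 9 L2744 (agreed by the lens L2745) with the edits (a) + (b) SANCTIONED. Port by census-1 gen 23 as `RootDecomp1KDescent01–06` (`--supports stmt-Schanuel-33364`; no census credit): 01 = §0 small facts, §1 the curves `dsP Q A = x²·Q(Y) + (2x+1)·A(Y)` (`dsC`, `bev_dsP`), §2 the level equation in integers, §3 the Eisenstein form of `F_Q` (`structure EisQ`) and the homogenised `Y⁶`-identity, §4 THE DESCENT LEMMA (`twist_mod_eight`, `twist_support`, `twist_kill`, `twist_le`, **`descent`**); 02 = §5 the 2-adic Runge step on the double cover (`exists_sign_small`, ultrametric bookkeeping in ℂ₂), §6 `structure DescentCert Q A` (integral data + identities only) and the integer `dsI`; 03 = §7 the lift of a level point to the cover read in ℂ₂ (‖I‖₂ ≤ (2/‖D‖₂)·2^{−3·N!} for one sign), §8 the norm `dsNu`, the archimedean size of `I`, the endgame (`endgame_ds`, cost 5 < 6 = 2μ); 04 = §9 THE ENGINE **`levelFinite_of_descentCert : DescentCert Q A → LevelFinite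 (dsP Q A)`** and `thinFibreAt_of_descentCert` (every m₀); 05 = §10 THE FAMILY `DJ λ` (`djQ = Y⁴+3Y³+3Y²+3`, `djA`, `DJ`), ONE certificate `djCert j` polynomial in λ = 3^j, **`levelFinite_DJ : ∀ j, LevelFinite (DJ (3^j))`**, **`thinFibreAt_DJ : ∀ j m₀, ThinFibreAt m₀ (DJ (3^j))`** HYPOTHESIS-FREE, `DJ_injective`, named members `DJ1` `DJ3` `DJ9`; 06 = §11 TERRITORY (section Territory) by tree names: `isEisensteinAt_djQ`, irreducibility of the top over ℚ, **`DJ_territory`**, the named members' territory. PORT EDITS: (a) 16 one-line docstrings quoting the signature on the undocumented decls (`dsC_two` / `dsC_one` / `dsC_zero` / `dsC_of_gt`, `natDegree_djA_le`, `natDegree_djT_le`, `natDegree_djF0_le` … `natDegree_djF3_le`, `levelFinite_DJ1/3/9`, `thinFibreAt_two_DJ1/3/9`); (b) PRIVATISATION ×5 of one-liners that the head dry-run flagged as near-duplicates of foreign / out-of-cone declarations — `odd_three_pow` (≡ a Crystal3D decl), `norm_intCast_le_one_ds` (≡ a BirchSwinnertonDyer decl; tree-private twins in Runge01 / LocalExponent01),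 `eight_dvd_sq_sub_one_ds` (≡ a HodgeConjecture decl), `isCoprime_num_den_ds` (≡ `Literature.NumberTheory.DiophantineApproximation.isCoprime_num_den`, not in the import cone), `odd_psNumer_ds` (≡ `RootDecomp1KCollarCell.odd_psNumer_two`, same summit but outside the cone — importing CollarCell02 would add 53 modules) — with file-local private copies re-emitted where a later part uses them (03: `norm_intCast_le_one_ds`, `odd_three_pow`; 04: `isCoprime_num_den_ds`, `odd_psNumer_ds`; 05: `odd_three_pow`); nothing else (no deletion, no replacement, no import added, no set_option; K's three `@[simp]` kept); provenance doc blocks + continuation headers = K's own open-lines; statements and proofs VERBATIM. Rung 0 — nothing here proves Schanuel, 33364, 33363, 31077 or ThinFibre 2; everything HYPOTHESIS-FREE.)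
-/

noncomputable section

namespace Summit.Schanuel.Schanuel.Theorems.RootDecomp1KDescent

open Polynomial LiouvilleNumber
open scoped Nat
open Summit.Schanuel.Schanuel.Theorems.RootDecomp1KTwoBaseCell (psNumer partialSum_eq_psNumer_div coprime_psNumer)
open Summit.Schanuel.Schanuel.Theorems.RootDecomp1KRelLiouvilleCell (partialSum_two_strictMono)
open Summit.Schanuel.Schanuel.Theorems.RootDecomp1KDegreeLadder
open Summit.Schanuel.Schanuel.Theorems.RootDecomp1KXLinear
open Summit.Schanuel.Schanuel.Theorems.RootDecomp1KXLinearII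
open Summit.Schanuel.Schanuel.Theorems.RootDecomp1KXTop
open Summit.Schanuel.Schanuel.Theorems.RootDecomp1KXAll
open Summit.Schanuel.Schanuel.Theorems.RootDecomp1KLevelFinite
open Summit.Schanuel.Schanuel.Theorems.RootDecomp1KThueMahler
open Summit.Schanuel.Schanuel.Theorems.RootDecomp1KParamThueMahler
open Summit.Schanuel.Schanuel.Theorems.RootDecomp1KLocalExponent
open Summit.Schanuel.Schanuel.Theorems.RootDecomp1KRunge

/-- `‖(z : ℂ₂)‖ ≤ 1` for integers. -/
private theorem norm_intCast_le_one_ds (z : ℤ) : ‖(z : PadicAlgCl 2)‖ ≤ 1 := by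
  have h1 : (z : PadicAlgCl 2) = algebraMap ℚ_[2] (PadicAlgCl 2) (z : ℚ_[2]) := (map_intCast _ z).symm
  rw [h1, PadicAlgCl.norm_extends]
  exact Padic.norm_int_le_one z

/-- an odd power of three: `Odd (3^j)`. -/
private theorem odd_three_pow (j : ℕ) : Odd ((3 : ℤ) ^ j) := Odd.pow (by decide)

/-! ### §7 The lift of a level point to the cover, read in `ℂ₂`: `‖I‖₂ ≤ (2/‖D‖₂)·2^{−3·N!}` for one sign -/

/-- `‖k‖₂ = 1` for an odd integer `k`. -/
theorem norm_eq_one_of_odd_ds {k : ℤ} (hk : Odd k) : ‖(k : PadicAlgCl 2)‖ = 1 :=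
  norm_eq_one_of_not_two_dvd (by rw [← even_iff_two_dvd]; exact Int.not_even_iff_odd.mpr hk)

/-- **THE LIFT, READ 2-ADICALLY.**  At a level `N ≥ 3`, a rational `r = u/d` (`u, d` odd) with
`F_A = −(g·p_N)²`, `F_Q = g²·2^{N!}·(2p_N + 2^{N!})` is the image of the point `(r, ±g·p_N/d², ±g·(p_N + 2^{N!})/d²)`
of the cover, 2-adically within `2^{−N!}` of the branch `O₊` over `x = ∞`; for ONE of the two signs the integer
`I` has `‖I‖₂ ≤ (2/‖D‖₂)·2^{−3·N!}` (`2·2^{−N!} < ‖D‖₂`). -/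
theorem exists_sign_small {Q A : ℤ[X]} (𝒞 : DescentCert Q A) {N : ℕ} {r : ℚ} {g : ℤ}
    (hu : Odd r.num) (hd : Odd (r.den : ℤ))
    (hFA : hf A 4 r = -(g * ((psNumer 2 N : ℕ) : ℤ)) ^ 2)
    (hFQ : hf Q 4 r = g ^ 2 * ((2 : ℤ) ^ N ! * (2 * ((psNumer 2 N : ℕ) : ℤ) + (2 : ℤ) ^ N !)))
    (hε : 2 * (1 / 2 : ℝ) ^ N ! < ‖(𝒞.D : PadicAlgCl 2)‖) :
    ∃ σ : ℤ, (σ = 1 ∨ σ = -1) ∧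
      ‖(dsI 𝒞.F0 𝒞.F1 𝒞.F2 𝒞.F3 𝒞.D r (σ * (g * psNumer 2 N))
          (σ * (g * (psNumer 2 N + 2 ^ N !))) : PadicAlgCl 2)‖ ≤
        2 / ‖(𝒞.D : PadicAlgCl 2)‖ * (1 / 2 : ℝ) ^ (3 * N !) := by
  -- the data in `ℂ₂`
  set p : ℤ := ((psNumer 2 N : ℕ) : ℤ) with hp
  set q : ℤ := (2 : ℤ) ^ N ! with hq
  set ε : ℝ := (1 / 2 : ℝ) ^ N ! with hεdef
  set y : PadicAlgCl 2 := (r : PadicAlgCl 2) with hydef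
  set dK : PadicAlgCl 2 := ((r.den : ℕ) : PadicAlgCl 2) with hdK
  set DK : PadicAlgCl 2 := (𝒞.D : PadicAlgCl 2) with hDK
  set μ : PadicAlgCl 2 := (((3 : ℤ) ^ 𝒞.j : ℤ) : PadicAlgCl 2) with hμdef
  have hdn : ‖dK‖ = 1 := by have := norm_eq_one_of_odd_ds hd; rwa [Int.cast_natCast] at this
  have hun : ‖(r.num : PadicAlgCl 2)‖ = 1 := norm_eq_one_of_odd_ds hu
  have hd0 : dK ≠ 0 := norm_pos_iff.mp (by rw [hdn]; norm_num)
  have hyud : y = (r.num : PadicAlgCl 2) / dK := by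
    rw [hydef, hdK, Rat.cast_def]
  have hyn : ‖y‖ = 1 := by rw [hyud, norm_div, hun, hdn, div_one]
  have hD0 : 0 < ‖DK‖ := norm_intCast_pos_ds 𝒞.hD
  have hD1 : ‖DK‖ ≤ 1 := norm_intCast_le_one_ds _
  have hμn : ‖μ‖ = 1 := norm_eq_one_of_odd_ds (odd_three_pow 𝒞.j)
  have hqn : ‖(q : PadicAlgCl 2)‖ = ε := by rw [hq]; push_cast; rw [norm_pow, norm_two_Cp]
  have hε0 : 0 < ε := by positivity
  have hε1 : 2 * ε < ‖DK‖ := hε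
  have hle1 : ∀ F : ℤ[X], ‖aeval y F‖ ≤ 1 := fun F => norm_aeval_le_one_ds F hyn.le
  -- the values of `Q`, `A`, `B = Q − A`
  have hQdeg : Q.natDegree ≤ 4 := 𝒞.eis.deg.le
  have hAdeg : A.natDegree ≤ 4 := 𝒞.hA.trans (by norm_num)
  have hQv : dK ^ 4 * aeval y Q = (g : PadicAlgCl 2) ^ 2 * ((q : PadicAlgCl 2) * (2 * p + q)) := by
    have := hf_cast_Cp hQdeg r; rw [hFQ] at this; push_cast at this; rw [← hdK, ← hydef] at this
    rw [← this]
  have hAv : dK ^ 4 * aeval y A = -((g : PadicAlgCl 2) * p) ^ 2 := by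
    have := hf_cast_Cp hAdeg r; rw [hFA] at this; push_cast at this; rw [← hdK, ← hydef] at this
    rw [← this]
  set ζ₁ : PadicAlgCl 2 := ((g * p : ℤ) : PadicAlgCl 2) / dK ^ 2 with hζ₁
  set ζ₂ : PadicAlgCl 2 := ((g * (p + q) : ℤ) : PadicAlgCl 2) / dK ^ 2 with hζ₂
  have hd2 : dK ^ 2 ≠ 0 := pow_ne_zero 2 hd0
  have hd4 : dK ^ 4 ≠ 0 := pow_ne_zero 4 hd0
  have hA' : aeval y A = -ζ₁ ^ 2 := by
    rw [hζ₁]; push_cast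
    field_simp
    linear_combination hAv
  have hB' : aeval y (Q - A) = ζ₂ ^ 2 := by
    rw [hζ₂, map_sub]; push_cast
    field_simp
    linear_combination hQv - hAv
  have hQn : ‖aeval y Q‖ ≤ ε := by
    have e : aeval y Q = (g : PadicAlgCl 2) ^ 2 * ((q : PadicAlgCl 2) * (2 * p + q)) / dK ^ 4 := by
      rw [← hQv]; field_simp
    rw [e, norm_div, norm_pow, hdn, one_pow, div_one, norm_mul, norm_mul, norm_pow, hqn]
    have h1 : ‖(g : PadicAlgCl 2)‖ ^ 2 ≤ 1 := pow_le_one₀ (norm_nonneg _) (norm_intCast_le_one_ds g)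
    have h2 : ‖(2 * (p : PadicAlgCl 2) + q)‖ ≤ 1 := by
      have := norm_intCast_le_one_ds (2 * p + q); push_cast at this; exact this
    calc ‖(g : PadicAlgCl 2)‖ ^ 2 * (ε * ‖2 * (p : PadicAlgCl 2) + (q : PadicAlgCl 2)‖) ≤ 1 * (ε * 1) := by
          gcongr
      _ = ε := by ring
  have hζd : ‖ζ₂ - ζ₁‖ ≤ ε := by
    have e : ζ₂ - ζ₁ = (g : PadicAlgCl 2) * q / dK ^ 2 := by rw [hζ₁, hζ₂]; push_cast; field_simp; ring
    rw [e, norm_div, norm_pow, hdn, one_pow, div_one, norm_mul, hqn]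
    calc ‖(g : PadicAlgCl 2)‖ * ε ≤ 1 * ε := mul_le_mul_of_nonneg_right (norm_intCast_le_one_ds g) hε0.le
      _ = ε := one_mul ε
  have hζn : ∀ z : ℤ, ‖((z : ℤ) : PadicAlgCl 2) / dK ^ 2‖ ≤ 1 := fun z => by
    rw [norm_div, norm_pow, hdn, one_pow, div_one]; exact norm_intCast_le_one_ds z
  have hζ2n : ‖ζ₂‖ ≤ 1 := hζn _
  -- the certificate, evaluated at `y`
  have hRid : aeval y 𝒞.Rz ^ 2 + DK ^ 2 * aeval y A = aeval y Q ^ 3 * aeval y 𝒞.U₁ := by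
    have := congrArg (aeval y) 𝒞.hR
    simpa only [map_add, map_mul, map_pow, map_intCast] using this
  have hSid : aeval y 𝒞.Sz ^ 2 - DK ^ 2 * aeval y (Q - A) = aeval y Q ^ 3 * aeval y 𝒞.U₂ := by
    have := congrArg (aeval y) 𝒞.hS
    simpa only [map_add, map_sub, map_mul, map_pow, map_intCast] using this
  have hRV : aeval y 𝒞.Rz = DK * μ * y ^ 3 + aeval y Q * aeval y 𝒞.V := by
    have := congrArg (aeval y) 𝒞.hRV
    simpa only [map_add, map_mul, map_pow, map_intCast, aeval_X] using this
  have hSW : aeval y 𝒞.Sz = aeval y 𝒞.Rz + aeval y Q * aeval y 𝒞.W := by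
    have := congrArg (aeval y) 𝒞.hSW
    simpa only [map_add, map_mul] using this
  have hΩ : DK ^ 2 * aeval y 𝒞.F0 + DK * aeval y 𝒞.F1 * aeval y 𝒞.Rz + DK * aeval y 𝒞.F2 * aeval y 𝒞.Sz +
      aeval y 𝒞.F3 * aeval y 𝒞.Rz * aeval y 𝒞.Sz = aeval y Q ^ 3 * aeval y 𝒞.Om := by
    have := congrArg (aeval y) 𝒞.hOm
    simpa only [map_add, map_mul, map_pow, map_intCast] using this
  -- `‖Rz(y)‖ = ‖D‖` and the sign choice
  have hRn : ‖aeval y 𝒞.Rz‖ = ‖DK‖ := by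
    have h1 : ‖DK * μ * y ^ 3‖ = ‖DK‖ := by rw [norm_mul, norm_mul, norm_pow, hμn, hyn]; ring
    have h2 : ‖aeval y Q * aeval y 𝒞.V‖ < ‖DK * μ * y ^ 3‖ := by
      rw [h1, norm_mul]
      exact lt_of_le_of_lt (mul_le_of_le_one_right (norm_nonneg _) (hle1 _)) (hQn.trans_lt (by linarith))
    rw [hRV, norm_add_eq_of_lt_ds h2, h1]
  obtain ⟨s, hs, hR1⟩ := sign_choice_ds hD0 hQn (hle1 𝒞.U₁) hA' hRid hRn
  obtain ⟨σ, hσ, hσs⟩ : ∃ σ : ℤ, (σ = 1 ∨ σ = -1) ∧ (σ : PadicAlgCl 2) = s := by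
    rcases hs with rfl | rfl
    · exact ⟨1, Or.inl rfl, by push_cast; rfl⟩
    · exact ⟨-1, Or.inr rfl, by push_cast; rfl⟩
  have hσ2 : (σ : PadicAlgCl 2) ^ 2 = 1 := by rcases hσ with rfl | rfl <;> norm_num
  have hσn : ‖(σ : PadicAlgCl 2)‖ = 1 := by rcases hσ with rfl | rfl <;> simp
  -- Runge on the cover at the signed point
  have hB'' : aeval y (Q - A) = (s * ζ₂) ^ 2 := by rw [← hσs, mul_pow, hσ2, one_mul]; exact hB'
  have hζ'' : ‖s * ζ₂ - s * ζ₁‖ ≤ ε := by rw [← mul_sub, norm_mul, ← hσs, hσn, one_mul]; exact hζd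
  have hζ2'' : ‖s * ζ₂‖ ≤ 1 := by rw [norm_mul, ← hσs, hσn, one_mul]; exact hζ2n
  have hmain := runge_cover_ds (F0 := aeval y 𝒞.F0) hyn hμn hD0 hD1 hQn hε1 (hle1 𝒞.V) (hle1 𝒞.W) (hle1 𝒞.U₂)
    (hle1 𝒞.F1) (hle1 𝒞.F2) (hle1 𝒞.F3) (hle1 𝒞.Om) hζ2'' hB'' hζ'' hSid hRV hSW hΩ hR1
  refine ⟨σ, hσ, ?_⟩
  -- the integer `I`, read in `ℂ₂`, is `d⁵ ×` the value bounded by `hmain`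
  have hI : (dsI 𝒞.F0 𝒞.F1 𝒞.F2 𝒞.F3 𝒞.D r (σ * (g * psNumer 2 N)) (σ * (g * (psNumer 2 N + 2 ^ N !))) :
      PadicAlgCl 2) = dK ^ 5 * (DK ^ 2 * aeval y 𝒞.F0 + DK * aeval y 𝒞.F1 * (DK * (s * ζ₁)) +
        DK * aeval y 𝒞.F2 * (DK * (s * ζ₂)) + aeval y 𝒞.F3 * (DK * (s * ζ₁)) * (DK * (s * ζ₂))) := by
    rw [dsI]; push_cast
    rw [hf_cast_Cp 𝒞.hF0, hf_cast_Cp 𝒞.hF1, hf_cast_Cp 𝒞.hF2, hf_cast_Cp 𝒞.hF3, ← hdK, ← hydef, ← hDK, ← hσs,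
      hζ₁, hζ₂, hp, hq]
    push_cast
    field_simp
  rw [hI, norm_mul, norm_pow, hdn, one_pow, one_mul]
  refine hmain.trans (le_of_eq ?_)
  have e3 : ε ^ 3 = (1 / 2 : ℝ) ^ (3 * N !) := by rw [hεdef, ← pow_mul, mul_comm]
  rw [e3]; ring

/-! ### §8 The norm `ν`, the archimedean size of `I`, the endgame -/

/-- `Φ(r, z₁, z₂) = 0` on the cover (`z₁² = −A(r)`, `z₂² = B(r)`) forces `ν(r) = 0`:
`g₀ + z₂g₁ = Φ·Φ₁ + (z₁² + A)(F₁ + F₃z₂)² − (z₂² − B)(F₂² + A·F₃²)` and `ν = (g₀ + z₂g₁)(g₀ − z₂g₁) + g₁²(z₂² − B)`. -/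
theorem nu_eq_zero_of_phi {Ar Br z₁ z₂ f0 f1 f2 f3 : ℚ} (h1 : z₁ ^ 2 = -Ar) (h2 : z₂ ^ 2 = Br)
    (hΦ : f0 + f1 * z₁ + f2 * z₂ + f3 * (z₁ * z₂) = 0) :
    (f0 ^ 2 + Br * f2 ^ 2 + Ar * f1 ^ 2 + Ar * Br * f3 ^ 2) ^ 2 - Br * (2 * (f0 * f2 + Ar * f1 * f3)) ^ 2 = 0 := by
  linear_combination
    (((f0 + f2 * z₂) - z₁ * (f1 + f3 * z₂)) *
        ((f0 ^ 2 + Br * f2 ^ 2 + Ar * f1 ^ 2 + Ar * Br * f3 ^ 2) - z₂ * (2 * (f0 * f2 + Ar * f1 * f3)))) * hΦ +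
      ((f1 + f3 * z₂) ^ 2 *
        ((f0 ^ 2 + Br * f2 ^ 2 + Ar * f1 ^ 2 + Ar * Br * f3 ^ 2) - z₂ * (2 * (f0 * f2 + Ar * f1 * f3)))) * h1 +
      ((2 * (f0 * f2 + Ar * f1 * f3)) ^ 2 - (f2 ^ 2 + Ar * f3 ^ 2) *
        ((f0 ^ 2 + Br * f2 ^ 2 + Ar * f1 ^ 2 + Ar * Br * f3 ^ 2) - z₂ * (2 * (f0 * f2 + Ar * f1 * f3)))) * h2

/-- `aeval r ν` unfolded. -/
theorem aeval_dsNu (Q A F0 F1 F2 F3 : ℤ[X]) (r : ℚ) :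
    aeval r (dsNu Q A F0 F1 F2 F3) =
      (aeval r F0 ^ 2 + aeval r (Q - A) * aeval r F2 ^ 2 + aeval r A * aeval r F1 ^ 2 +
          aeval r A * aeval r (Q - A) * aeval r F3 ^ 2) ^ 2 -
        aeval r (Q - A) * (2 * (aeval r F0 * aeval r F2 + aeval r A * aeval r F1 * aeval r F3)) ^ 2 := by
  simp only [dsNu, map_sub, map_add, map_mul, map_pow, map_ofNat]

/-- the rational roots of a non-zero `ν ∈ ℤ[Y]` are finitely many. -/
theorem roots_finite_ds (ν : ℤ[X]) (hν : ν ≠ 0) : {r : ℚ | aeval r ν = 0}.Finite := by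
  classical
  set νQ : ℚ[X] := ν.map (Int.castRingHom ℚ) with hνQ
  have hνQ0 : νQ ≠ 0 := by
    rw [hνQ]; exact (Polynomial.map_ne_zero_iff (Int.castRingHom ℚ).injective_int).mpr hν
  refine (νQ.roots.toFinset.finite_toSet).subset ?_
  intro r hr
  have hr' : aeval r ν = 0 := hr
  show r ∈ (νQ.roots.toFinset : Set ℚ)
  rw [Finset.mem_coe, Multiset.mem_toFinset, mem_roots hνQ0, IsRoot.def, hνQ, eval_map, ← algebraMap_int_eq,
    ← aeval_def]
  exact hr'

/-- a Bezout identity `Ba·A + Bb·B = m ≠ 0` in `ℤ[Y]` makes `A ⊥ B` in `ℚ[Y]`. -/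
theorem isCoprime_of_bezout {A B Ba Bb : ℤ[X]} {m : ℤ} (h : Ba * A + Bb * B = (m : ℤ[X])) (hm : m ≠ 0) :
    IsCoprime (A.map (Int.castRingHom ℚ)) (B.map (Int.castRingHom ℚ)) := by
  have hmQ : (m : ℚ) ≠ 0 := by exact_mod_cast hm
  refine ⟨Polynomial.C (m : ℚ)⁻¹ * Ba.map (Int.castRingHom ℚ), Polynomial.C (m : ℚ)⁻¹ * Bb.map (Int.castRingHom ℚ), ?_⟩
  have h' := congrArg (Polynomial.map (Int.castRingHom ℚ)) h
  simp only [Polynomial.map_add, Polynomial.map_mul, Polynomial.map_intCast] at h'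
  rw [mul_assoc, mul_assoc, ← mul_add, h', ← map_intCast (Polynomial.C : ℚ →+* ℚ[X]) m, ← Polynomial.C_mul,
    inv_mul_cancel₀ hmQ, Polynomial.C_1]

/-- the ARCHIMEDEAN size of `I`: `|I| ≤ K₄ · den(r) · q²` (`|z₁| ≤ 2Lq`, `|z₂| ≤ 3Lq`, `den(r)² ≤ K₃q`). -/
theorem abs_dsI_le {F0 F1 F2 F3 : ℤ[X]} (h0 : F0.natDegree ≤ 5) (h1 : F1.natDegree ≤ 3) (h2 : F2.natDegree ≤ 3)
    (h3 : F3.natDegree ≤ 1) {M0 M1 M2 M3 C : ℝ} (hM0 : ∀ t : ℝ, |t| ≤ C → |aeval t F0| ≤ M0)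
    (hM1 : ∀ t : ℝ, |t| ≤ C → |aeval t F1| ≤ M1) (hM2 : ∀ t : ℝ, |t| ≤ C → |aeval t F2| ≤ M2)
    (hM3 : ∀ t : ℝ, |t| ≤ C → |aeval t F3| ≤ M3) (D : ℤ) {r : ℚ} (hr : |(r : ℝ)| ≤ C) {z₁ z₂ : ℤ}
    {L q K₃ : ℝ} (hL : 0 ≤ L) (hq : 0 ≤ q) (hz1 : |(z₁ : ℝ)| ≤ 2 * L * q) (hz2 : |(z₂ : ℝ)| ≤ 3 * L * q)
    (hd : ((r.den : ℝ)) ^ 2 ≤ K₃ * q) :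
    |(dsI F0 F1 F2 F3 D r z₁ z₂ : ℝ)| ≤
      (D : ℝ) ^ 2 * (M0 * K₃ ^ 2 + 2 * L * M1 * K₃ + 3 * L * M2 * K₃ + 6 * L ^ 2 * M3) * ((r.den : ℝ) * q ^ 2) := by
  set d : ℝ := (r.den : ℝ) with hdd
  have hd0 : 0 ≤ d := by positivity
  have hK : 0 ≤ K₃ * q := le_trans (sq_nonneg d) hd
  have hM0' : 0 ≤ M0 := (abs_nonneg _).trans (hM0 _ hr)
  have hM1' : 0 ≤ M1 := (abs_nonneg _).trans (hM1 _ hr)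
  have hM2' : 0 ≤ M2 := (abs_nonneg _).trans (hM2 _ hr)
  have hM3' : 0 ≤ M3 := (abs_nonneg _).trans (hM3 _ hr)
  have hLq2 : 0 ≤ 2 * L * q := by positivity
  have hLq3 : 0 ≤ 3 * L * q := by positivity
  have hd2 : d ^ 2 ≤ K₃ * q := hd
  have hd4 : (d ^ 2) ^ 2 ≤ (K₃ * q) ^ 2 := pow_le_pow_left₀ (sq_nonneg _) hd2 2
  have e0 : |((hf F0 5 r : ℤ) : ℝ)| ≤ d * (K₃ * q) ^ 2 * M0 := by
    rw [abs_hf_eq h0, ← hdd, show d ^ 5 = d * (d ^ 2) ^ 2 by ring]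
    exact mul_le_mul (mul_le_mul_of_nonneg_left hd4 hd0) (hM0 _ hr) (abs_nonneg _)
      (mul_nonneg hd0 (sq_nonneg _))
  have e1 : |((hf F1 3 r : ℤ) : ℝ) * z₁| ≤ d * (K₃ * q) * M1 * (2 * L * q) := by
    rw [abs_mul, abs_hf_eq h1, ← hdd, show d ^ 3 = d * d ^ 2 by ring]
    exact mul_le_mul (mul_le_mul (mul_le_mul_of_nonneg_left hd2 hd0) (hM1 _ hr) (abs_nonneg _)
      (mul_nonneg hd0 hK)) hz1 (abs_nonneg _) (mul_nonneg (mul_nonneg hd0 hK) hM1')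
  have e2 : |((hf F2 3 r : ℤ) : ℝ) * z₂| ≤ d * (K₃ * q) * M2 * (3 * L * q) := by
    rw [abs_mul, abs_hf_eq h2, ← hdd, show d ^ 3 = d * d ^ 2 by ring]
    exact mul_le_mul (mul_le_mul (mul_le_mul_of_nonneg_left hd2 hd0) (hM2 _ hr) (abs_nonneg _)
      (mul_nonneg hd0 hK)) hz2 (abs_nonneg _) (mul_nonneg (mul_nonneg hd0 hK) hM2')
  have e3 : |((hf F3 1 r : ℤ) : ℝ) * ((z₁ : ℝ) * (z₂ : ℝ))| ≤ d * M3 * ((2 * L * q) * (3 * L * q)) := by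
    rw [abs_mul, abs_hf_eq h3, ← hdd, pow_one, abs_mul]
    exact mul_le_mul (mul_le_mul_of_nonneg_left (hM3 _ hr) hd0) (mul_le_mul hz1 hz2 (abs_nonneg _) hLq2)
      (mul_nonneg (abs_nonneg _) (abs_nonneg _)) (mul_nonneg hd0 hM3')
  rw [dsI]; push_cast
  rw [abs_mul, abs_pow, sq_abs]
  have hsum : |((hf F0 5 r : ℤ) : ℝ) + (hf F1 3 r : ℤ) * (z₁ : ℝ) + (hf F2 3 r : ℤ) * (z₂ : ℝ) +
      (hf F3 1 r : ℤ) * ((z₁ : ℝ) * (z₂ : ℝ))| ≤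
      d * (K₃ * q) ^ 2 * M0 + d * (K₃ * q) * M1 * (2 * L * q) + d * (K₃ * q) * M2 * (3 * L * q) +
        d * M3 * ((2 * L * q) * (3 * L * q)) :=
    (abs_add_le _ _).trans (add_le_add ((abs_add_le _ _).trans (add_le_add ((abs_add_le _ _).trans
      (add_le_add e0 e1)) e2)) e3)
  calc (D : ℝ) ^ 2 * |((hf F0 5 r : ℤ) : ℝ) + (hf F1 3 r : ℤ) * (z₁ : ℝ) + (hf F2 3 r : ℤ) * (z₂ : ℝ) +
        (hf F3 1 r : ℤ) * ((z₁ : ℝ) * (z₂ : ℝ))|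
      ≤ (D : ℝ) ^ 2 * (d * (K₃ * q) ^ 2 * M0 + d * (K₃ * q) * M1 * (2 * L * q) + d * (K₃ * q) * M2 * (3 * L * q) +
        d * M3 * ((2 * L * q) * (3 * L * q))) := mul_le_mul_of_nonneg_left hsum (sq_nonneg _)
    _ = (D : ℝ) ^ 2 * (M0 * K₃ ^ 2 + 2 * L * M1 * K₃ + 3 * L * M2 * K₃ + 6 * L ^ 2 * M3) * (d * q ^ 2) := by ring

/-- the ENDGAME: `q³ ≤ K_D·|I|` (product formula, if `I ≠ 0`), `|I| ≤ K₄·d·q²`, `d² ≤ K₃·q` and `K_D²K₄²K₃ < q`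
force `I = 0`. -/
theorem endgame_ds {I : ℤ} {KD K₄ K₃ q d : ℝ} (hq : 0 < q)
    (hI : I ≠ 0 → q ^ 3 ≤ KD * |(I : ℝ)|) (habs : |(I : ℝ)| ≤ K₄ * (d * q ^ 2)) (hd : d ^ 2 ≤ K₃ * q)
    (hbig : KD ^ 2 * K₄ ^ 2 * K₃ < q) : I = 0 := by
  by_contra hI0
  have h := hI hI0
  have hK₄ : 0 ≤ K₄ * (d * q ^ 2) := (abs_nonneg _).trans habs
  have h6 : (q ^ 3) ^ 2 ≤ (KD * |(I : ℝ)|) ^ 2 := pow_le_pow_left₀ (by positivity) h 2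
  have h7 : (KD * |(I : ℝ)|) ^ 2 ≤ KD ^ 2 * (K₄ * (d * q ^ 2)) ^ 2 := by
    rw [mul_pow]; exact mul_le_mul_of_nonneg_left (pow_le_pow_left₀ (abs_nonneg _) habs 2) (sq_nonneg _)
  have h8 : KD ^ 2 * (K₄ * (d * q ^ 2)) ^ 2 ≤ KD ^ 2 * K₄ ^ 2 * K₃ * q ^ 5 := by
    have : KD ^ 2 * (K₄ * (d * q ^ 2)) ^ 2 = KD ^ 2 * K₄ ^ 2 * q ^ 4 * d ^ 2 := by ring
    rw [this]
    calc KD ^ 2 * K₄ ^ 2 * q ^ 4 * d ^ 2 ≤ KD ^ 2 * K₄ ^ 2 * q ^ 4 * (K₃ * q) :=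
          mul_le_mul_of_nonneg_left hd (by positivity)
      _ = KD ^ 2 * K₄ ^ 2 * K₃ * q ^ 5 := by ring
  have h9 : KD ^ 2 * K₄ ^ 2 * K₃ * q ^ 5 < q * q ^ 5 := mul_lt_mul_of_pos_right hbig (by positivity)
  have : (q ^ 3) ^ 2 = q * q ^ 5 := by ring
  linarith

end Summit.Schanuel.Schanuel.Theorems.RootDecomp1KDescent

end
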